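import Mathlib.CategoryTheory.Comma.Over.Basic
import Literature.AnabelianGeometry.SemiGraphs.GaloisCountableGraphs
import Literature.AnabelianGeometry.Anabelioids.GaloisImages

/-!
# Fibres of pull-backs in a Galois category: points, components under a sub-object, base change

[SGA1, Exp. V §4–§5]: a fibre functor `F` of a Galois category preserves fibre products and reflects
isomorphisms [cite: SGA1, Exp. V §4 (condition (G6))]; used throughout [SemiAnbd] §2 (Mochizuki,
*Semi-graphs of anabelioids*, Publ. RIMS **42** (2006), Def. 2.2 (i), p. 23: the vertices of the covering
attached to `A` over `v` are "the connected components of `S_v`") [cite: MochizukiSemiAnbd2006, Def. 2.2(i) p.23].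

PROOF-ONLY toolkit (abc-iut-L3-d3, row RS-cov of the (D3) dictionary; no definitions):

* `fiber_pullback_ext`, `exists_fiber_pullback` — points of `F(A ×_X B)` are the compatible pairs;
* `isIso_of_fiber_bijective` — bijective on fibres ⇒ isomorphism;
* `isIso_pullback_snd_of_range_subset` — for a monomorphism `n : Z₀ ↪ S` and a connected component
  `P ⊆ S` with `F(P) ⊆ F(n)`, the projection `Z₀ ×_S P → P` is an isomorphism;
* `isEmpty_fiber_pullback_of_disjoint` — if `F(P)` avoids `F(n)` then `Y₀ ×_S P` has empty fibre for every
  `Y₀ → Z₀ ↪ S`;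
* `isIso_pullback_map_of_range_subset` — base change along `Z₀ ↪ S` is invisible after `(−) ×_{Φ S} P` for
  components `P` under `Φ Z₀`, for a functor `Φ` into the Galois category;
* `nonempty_isInitial_over_of_left` — an object of `Over P` with initial underlying object is initial.

Nothing here takes a side on [IUTchIII] Cor. 3.12.
-/

namespace Literature.AnabelianGeometry.Anabelioids

open CategoryTheory CategoryTheory.Limits CategoryTheory.PreGaloisCategory
open Literature.AnabelianGeometry.SemiGraphs

universe w v₂ u₂ v₃ u₃

-- Mathlib's `pullback.lift_fst`-type simp lemmas and the `Over` API, as in `Over/Pullback.lean`.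
set_option backward.isDefEq.respectTransparency false

/-! ### Fibre tools in an abstract Galois category -/

section FibreTools

variable {D : Type u₃} [Category.{v₃} D] [GaloisCategory D] (F : D ⥤ FintypeCat.{w}) [FiberFunctor F]

/-- Points of the fibre of a pull-back are determined by their two projections.
[cite: SGA1, Exp. V §4 (fibre functors preserve fibre products)] -/
theorem fiber_pullback_ext {X A B : D} {f : A ⟶ X} {g : B ⟶ X} {q₁ q₂ : F.obj (pullback f g)}
    (h₁ : F.map (pullback.fst f g) q₁ = F.map (pullback.fst f g) q₂)
    (h₂ : F.map (pullback.snd f g) q₁ = F.map (pullback.snd f g) q₂) : q₁ = q₂ := by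
  set e := fiberPullbackEquiv F f g with he
  have hfst : ∀ q : F.obj (pullback f g), F.map (pullback.fst f g) q = (e q).1.1 := fun q => by
    conv_lhs => rw [← e.symm_apply_apply q]
    exact fiberPullbackEquiv_symm_fst_apply F (e q).1.1 (e q).1.2 (e q).2
  have hsnd : ∀ q : F.obj (pullback f g), F.map (pullback.snd f g) q = (e q).1.2 := fun q => by
    conv_lhs => rw [← e.symm_apply_apply q]
    exact fiberPullbackEquiv_symm_snd_apply F (e q).1.1 (e q).1.2 (e q).2
  apply e.injective
  rw [hfst, hfst] at h₁
  rw [hsnd, hsnd] at h₂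
  exact Subtype.ext (Prod.ext h₁ h₂)

/-- A compatible pair of points lifts to the fibre of the pull-back.
[cite: SGA1, Exp. V §4 (fibre functors preserve fibre products)] -/
theorem exists_fiber_pullback {X A B : D} (f : A ⟶ X) (g : B ⟶ X) (a : F.obj A) (b : F.obj B)
    (h : F.map f a = F.map g b) :
    ∃ q : F.obj (pullback f g), F.map (pullback.fst f g) q = a ∧ F.map (pullback.snd f g) q = b :=
  ⟨(fiberPullbackEquiv F f g).symm ⟨(a, b), h⟩, fiberPullbackEquiv_symm_fst_apply F a b h,
    fiberPullbackEquiv_symm_snd_apply F a b h⟩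

/-- A morphism bijective on fibres is an isomorphism (fibre functors reflect isomorphisms).
[cite: SGA1, Exp. V §4 (condition (G6))] -/
theorem isIso_of_fiber_bijective {X Y : D} (f : X ⟶ Y) (h : Function.Bijective (F.map f)) :
    IsIso f := by
  haveI : IsIso (F.map f) := (ConcreteCategory.isIso_iff_bijective (F.map f)).mpr h
  exact isIso_of_reflects_iso f F

/-- **A component under a sub-object is cut out by it**: for a monomorphism `n : Z₀ ↪ S` and a
connected component `P ⊆ S` whose fibre-image lies in that of `n`, the projection `Z₀ ×_S P → P` is an
isomorphism (a monomorphism onto a connected object, surjective on fibres).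
[cite: MochizukiSemiAnbd2006, Def. 2.2(i) p.23] -/
theorem isIso_pullback_snd_of_range_subset {S Z₀ : D} (n : Z₀ ⟶ S) [Mono n] (P : π₀Obj S)
    (h : Set.range (F.map P.1.arrow) ⊆ Set.range (F.map n)) : IsIso (pullback.snd n P.1.arrow) := by
  refine isIso_of_mono_of_surjective_fiber F (pullback.snd n P.1.arrow) fun p => ?_
  obtain ⟨z, hz⟩ := h ⟨p, rfl⟩
  obtain ⟨q, -, hq⟩ := exists_fiber_pullback F n P.1.arrow z p hz
  exact ⟨q, hq⟩

omit [FiberFunctor F] in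
/-- **A component disjoint from a sub-object**: for a monomorphism `n : Z₀ ↪ S` and a connected component
`P ⊆ S` whose fibre-image avoids that of `n`, the fibre of `Y₀ ×_S P` is empty for every `Y₀ → Z₀ → S`.
[cite: MochizukiSemiAnbd2006, Def. 2.2(i) p.23] -/
theorem isEmpty_fiber_pullback_of_disjoint {S Z₀ Y₀ : D} (n : Z₀ ⟶ S) (g : Y₀ ⟶ Z₀) (P : π₀Obj S)
    (h : ∀ x ∈ Set.range (F.map P.1.arrow), x ∉ Set.range (F.map n)) :
    IsEmpty (F.obj (pullback (g ≫ n) P.1.arrow)) := by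
  refine ⟨fun q => h _ ⟨F.map (pullback.snd (g ≫ n) P.1.arrow) q, rfl⟩
    ⟨F.map g (F.map (pullback.fst (g ≫ n) P.1.arrow) q), ?_⟩⟩
  have hc : F.map (g ≫ n) (F.map (pullback.fst (g ≫ n) P.1.arrow) q) =
      F.map P.1.arrow (F.map (pullback.snd (g ≫ n) P.1.arrow) q) := by
    conv_lhs => rw [← FintypeCat.comp_apply, ← F.map_comp, pullback.condition, F.map_comp,
      FintypeCat.comp_apply]
  rw [← hc, F.map_comp, FintypeCat.comp_apply]

end FibreTools

/-! ### The base-change lemma -/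

section BaseChange

variable {C : Type u₂} [Category.{v₂} C] [HasPullbacks C] {D : Type u₃} [Category.{v₃} D]
  [GaloisCategory D] (Φ : C ⥤ D) (F : D ⥤ FintypeCat.{w}) [FiberFunctor F]

/-- **Base change along a sub-object is invisible on the components under it.**  Let `Φ : C ⥤ D` be a
functor into a Galois category sending a monomorphism `m : Z₀ ↪ S` to a monomorphism and such that
`Φ ⋙ F` is a fibre functor-like enough to compute the fibre of `Y ×_S Z₀` (we only use the lifting of
compatible pairs, supplied as the hypothesis `hlift`); let `P ⊆ Φ S` be a connected component with
`F(P) ⊆ F(Φ m)`.  Then for `y : Y → S` the morphism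
`Φ(Y ×_S Z₀) ×_{Φ S} P → Φ(Y) ×_{Φ S} P` induced by the first projection is an isomorphism (bijective on
fibres: injective because `Φ(pr₁)` is a monomorphism, surjective because points of `P` lift to `Z₀`).
[cite: MochizukiSemiAnbd2006, Def. 2.2(i) p.23] -/
theorem isIso_pullback_map_of_range_subset {Y S Z₀ : C} (y : Y ⟶ S) (m : Z₀ ⟶ S)
    [Mono (Φ.map m)] [Mono (Φ.map (pullback.fst y m))]
    (hlift : ∀ (a : F.obj (Φ.obj Y)) (z : F.obj (Φ.obj Z₀)), F.map (Φ.map y) a = F.map (Φ.map m) z →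
      ∃ c : F.obj (Φ.obj (pullback y m)), F.map (Φ.map (pullback.fst y m)) c = a ∧
        F.map (Φ.map (pullback.snd y m)) c = z)
    (P : π₀Obj (Φ.obj S)) (hP : Set.range (F.map P.1.arrow) ⊆ Set.range (F.map (Φ.map m)))
    (u : Φ.obj (pullback y m) ⟶ Φ.obj S) (hu : u = Φ.map (pullback.snd y m) ≫ Φ.map m)
    (w₁ : u ≫ 𝟙 _ = Φ.map (pullback.fst y m) ≫ Φ.map y) (w₂ : P.1.arrow ≫ 𝟙 _ = 𝟙 _ ≫ P.1.arrow) :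
    IsIso (pullback.map u P.1.arrow (Φ.map y) P.1.arrow (Φ.map (pullback.fst y m)) (𝟙 _) (𝟙 _)
      w₁ w₂) := by
  set L := pullback.map u P.1.arrow (Φ.map y) P.1.arrow (Φ.map (pullback.fst y m)) (𝟙 _) (𝟙 _) w₁ w₂
    with hL
  have hL₁ : L ≫ pullback.fst (Φ.map y) P.1.arrow =
      pullback.fst u P.1.arrow ≫ Φ.map (pullback.fst y m) := by
    simp only [hL, pullback.lift_fst]
  have hL₂ : L ≫ pullback.snd (Φ.map y) P.1.arrow = pullback.snd u P.1.arrow := by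
    simp only [hL, pullback.lift_snd, Category.comp_id]
  have hinj : Function.Injective (F.map (Φ.map (pullback.fst y m))) :=
    ConcreteCategory.injective_of_mono_of_preservesPullback _
  refine isIso_of_fiber_bijective F L ⟨fun q₁ q₂ hq => ?_, fun r => ?_⟩
  · -- injective
    apply fiber_pullback_ext F
    · apply hinj
      rw [← FintypeCat.comp_apply, ← F.map_comp, ← hL₁, F.map_comp, FintypeCat.comp_apply, hq,
        ← FintypeCat.comp_apply, ← F.map_comp, hL₁, F.map_comp, FintypeCat.comp_apply]
    · rw [← hL₂, F.map_comp, FintypeCat.comp_apply, hq, ← FintypeCat.comp_apply, ← F.map_comp]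
  · -- surjective
    set a := F.map (pullback.fst (Φ.map y) P.1.arrow) r with ha
    set p := F.map (pullback.snd (Φ.map y) P.1.arrow) r with hp
    have hap : F.map (Φ.map y) a = F.map P.1.arrow p := by
      rw [ha, hp, ← FintypeCat.comp_apply, ← F.map_comp, pullback.condition, F.map_comp,
        FintypeCat.comp_apply]
    obtain ⟨z, hz⟩ := hP ⟨p, rfl⟩
    obtain ⟨c, hc₁, hc₂⟩ := hlift a z (hap.trans hz.symm)
    have hcu : F.map u c = F.map P.1.arrow p := by
      rw [hu, F.map_comp, FintypeCat.comp_apply, hc₂, hz]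
    obtain ⟨q, hq₁, hq₂⟩ := exists_fiber_pullback F u P.1.arrow c p hcu
    refine ⟨q, fiber_pullback_ext F ?_ ?_⟩
    · rw [← FintypeCat.comp_apply, ← F.map_comp, hL₁, F.map_comp, FintypeCat.comp_apply, hq₁, hc₁]
    · rw [← FintypeCat.comp_apply, ← F.map_comp, hL₂, hq₂]

end BaseChange

/-! ### Initial objects of over categories -/

/-- An object of `Over P` whose underlying object is initial is initial (bookkeeping for the component
anabelioids `(𝒢_v)_P = Over P` of [SemiAnbd] Def. 2.2 (i)). [cite: MochizukiSemiAnbd2006, Def. 2.2(i) p.23] -/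
theorem nonempty_isInitial_over_of_left {C : Type u₂} [Category.{v₂} C] {P : C} (U : Over P)
    (h : IsInitial U.left) : Nonempty (IsInitial U) :=
  ⟨IsInitial.ofUniqueHom (fun V => Over.homMk (h.to V.left) (h.hom_ext _ _))
    fun _ _ => Over.OverMorphism.ext (h.hom_ext _ _)⟩

end Literature.AnabelianGeometry.Anabelioids
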